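import Summits.CriticalPhenomena.CardyFormulaZ2.Theorems.CardyIKTransportIKLinearTransportStubCutMarkovKernelGlue

/-!
# Stub `stub_CutMarkovKernel` (K) — part F: the ROW STATISTIC through the three samples

Support file (`--supports stmt-CriticalPhenomena-5076`, registered sub-goal `cmk_key`).

For a cut row `c ≤ -1` and the glued configuration `x = cmkΞ (cmkGlue3 (a, θ, b))` of three independent
samples (lower data `a`, shared data `θ`, upper noise `b`):

* UPPER MAPS, functions of `(θ, b)` (computed on the reference lower sample `cmkA0`): the middle row `0`
  (`cmkY`), the middle rows `(c, 0)` (`cmkV`), and the UPPER STATISTIC `cmkUst` = (upper half-diagram with pivot,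
  `pivot ∼ (i,c+2)`, `(i,c) ≁ (i+2,c)`) read on `cmkFlat` (row-`c` flags set);
* LOWER MAPS, functions of `(a, θ)`: the environment `eraseMid`, the middle rows `≤ c`, the lower half-strip
  reachability and the boundary pattern (`cmkLconf`);
* `cmk_key` (registered) — THE IDENTIFICATION: (a) `rowBool x = cmkY`, rows `(c,0)` of `x` = `cmkV`;
  (b) `c` is a cut row of `x` iff the LOWER conditions hold for `(a, θ)` and the UPPER statistic says so
  (`cmk_isCut_iff_cutLoc`); (c) at a cut row the row statistic of `x` is REASSEMBLED (`cmkRS`) from the lower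
  maps and the upper statistic (`cmk_stripDiagram_eq_comb`), the upper statistic is READ OFF the strip diagram
  (`cmk_pi2_stripDiagram`), and the shared coordinates are READ OFF THE ENVIRONMENT (`cmkΓ`: boundary colours
  and, the middle colour at the cut being forced, the re-anchored column bit).
-/

noncomputable section

namespace Summit.CriticalPhenomena.CardyFormulaZ2.Theorems.IKLinearTransport.PinnedDiagramExchange

open scoped Classical MeasureTheory ENNReal ProbabilityTheory symmDiff
open Set MeasureTheory
open Literature.Probability.Percolation Literature.Probability.LatticeModels

/-! ## Vocabulary -/

/-- The reference sample (all bits cleared). [folklore] -/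
def cmkA0 : SDE.KJ := fun _ => false

/-- The glued configuration of three samples. [folklore] -/
def cmkConf (i : ℤ) (T : Set ℤ) (c : ℤ) (p : SDE.KJ × SDE.KJ × SDE.KJ) : Obs :=
  cmkΞ i T c (cmkGlue3 i (decide (i ∈ T)) c p)

/-- The UPPER reference configuration of `(θ, b)`. [folklore] -/
def cmkUconf (i : ℤ) (T : Set ℤ) (c : ℤ) (θb : SDE.KJ × SDE.KJ) : Obs := cmkConf i T c (cmkA0, θb.1, θb.2)

/-- The LOWER reference configuration of `(a, θ)`. [folklore] -/
def cmkLconf (i : ℤ) (T : Set ℤ) (c : ℤ) (aθ : SDE.KJ × SDE.KJ) : Obs := cmkConf i T c (aθ.1, aθ.2, cmkA0)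

/-- Middle data strictly above the row `c`. [folklore] -/
def cmkTrunc (c : ℤ) (z : Obs) : Obs := ({v | v ∈ z.1 ∧ c < v 1}, {f | f ∈ z.2 ∧ c < f 1})

/-- Componentwise union of observables. [folklore] -/
def cmkUn (z z' : Obs) : Obs := (z.1 ∪ z'.1, z.2 ∪ z'.2)

/-- UPPER MAP: the middle row `0`. [folklore] -/
def cmkY (i : ℤ) (T : Set ℤ) (c : ℤ) (θb : SDE.KJ × SDE.KJ) : Bool × Bool × Bool := rowBool i (cmkUconf i T c θb)

/-- UPPER MAP: the middle rows `(c, 0)`. [folklore] -/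
def cmkV (i : ℤ) (T : Set ℤ) (c : ℤ) (θb : SDE.KJ × SDE.KJ) : Obs := cmkTrunc c (pastMid i 0 (cmkUconf i T c θb))

/-- The upper statistic of a configuration, read on `cmkFlat`. [folklore] -/
def cmkUstat (i c : ℤ) (x : Obs) : Set (Site 2 × Site 2) × Prop × Prop :=
  (cmkUpDp i c (cmkFlat i c x), ((![i + 1, c], ![i, c + 2]) : Site 2 × Site 2) ∈ cmkUpR i c (cmkFlat i c x),
    ((![i, c], ![i + 2, c]) : Site 2 × Site 2) ∉ cmkUpR i c (cmkFlat i c x))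

/-- UPPER MAP: the upper statistic. [folklore] -/
def cmkUst (i : ℤ) (T : Set ℤ) (c : ℤ) (θb : SDE.KJ × SDE.KJ) : Set (Site 2 × Site 2) × Prop × Prop :=
  cmkUstat i c (cmkUconf i T c θb)

/-- The cut, from the lower configuration and an upper statistic. [folklore] -/
def cmkC (i c : ℤ) (xlo : Obs) (u : Set (Site 2 × Site 2) × Prop × Prop) : Prop :=
  cmkPattern i c xlo ∧ ((![i, c], ![i + 2, c]) : Site 2 × Site 2) ∉ cmkLoR i c xlo ∧
    ((![i, c - 2], ![i + 1, c]) : Site 2 × Site 2) ∈ cmkLoR i c xlo ∧ u.2.2 ∧ u.2.1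

/-- The row statistic REASSEMBLED from the lower configuration, an upper statistic and the rows `(c, 0)`. [folklore] -/
def cmkRS (i c : ℤ) (xlo : Obs) (u : Set (Site 2 × Site 2) × Prop × Prop) (v : Obs) : (Obs × Set (Site 2 × Site 2)) × Obs :=
  ((eraseMid i xlo, cmkComb i c (cmkLoR i c xlo) u.1), cmkUn (pastMid i (c + 1) xlo) v)

/-- The upper statistic READ OFF a diagram. [folklore] -/
def cmkPi2' (i c : ℤ) (D : Set (Site 2 × Site 2)) : Set (Site 2 × Site 2) × Prop × Prop := (cmkPi2 i c D, True, True)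

/-- Left boundary colour read on the environment. [folklore] -/
def cmkξE (i : ℤ) (E : Obs) (y : ℤ) : Bool := decide ((![i, y] : Site 2) ∈ E.1)

/-- Right boundary colour read on the environment. [folklore] -/
def cmkζE (i : ℤ) (E : Obs) (y : ℤ) : Bool := decide ((![i + 2, y] : Site 2) ∈ E.1)

/-- Honeycomb fair plaquettes read on the environment. [folklore] -/
def cmkFE (i : ℤ) (E : Obs) (y : ℤ) : Bool := cmkζE i E (y + 1) ^^ cmkξE i E (y + 1) ^^ cmkζE i E y ^^ cmkξE i E y

/-- THE SHARED COORDINATES READ OFF THE ENVIRONMENT (valid at a cut row `c`). [folklore] -/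
def cmkΓ (i : ℤ) (τ : Bool) (c : ℤ) (E : Obs) : SDE.KJ
  | Sum.inl x => (decide (x = i + 2) && (cmkζE i E 0 ^^ cmkξE i E 0)) || (decide (x = i + 1) && !(!τ && SDE.bp (cmkFE i E) 0 c))
  | Sum.inr (Sum.inl y) => decide (c ≤ y) && cmkξE i E y
  | Sum.inr (Sum.inr (Sum.inr (Sum.inl f))) => decide (f 0 = SDE.hcC i τ ∧ c ≤ f 1) && cmkFE i E (f 1)
  | _ => false

/-! ## What the glued configuration reads -/

section Key

variable (i : ℤ) {T : Set ℤ} (c : ℤ) (hT : i ∈ T ↔ i + 1 ∉ T) (hc : c ≤ -1)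
include hT hc

omit hc in
/-- Lower agreement of the glued configuration with the lower reference configuration. [folklore] -/
theorem cmk_conf_lo (a θ b : SDE.KJ) :
    (∀ v : Site 2, (v 0 = i ∨ v 0 = i + 2) → (v ∈ (cmkConf i T c (a, θ, b)).1 ↔ v ∈ (cmkLconf i T c (a, θ)).1)) ∧
    (∀ v : Site 2, v 0 = i + 1 → v 1 ≤ c → (v ∈ (cmkConf i T c (a, θ, b)).1 ↔ v ∈ (cmkLconf i T c (a, θ)).1)) ∧
    (∀ f : Site 2, (f 0 = i ∨ f 0 = i + 1) → f 1 ≤ c → (f ∈ (cmkConf i T c (a, θ, b)).2 ↔ f ∈ (cmkLconf i T c (a, θ)).2)) ∧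
    eraseMid i (cmkConf i T c (a, θ, b)) = eraseMid i (cmkLconf i T c (a, θ)) :=
  cmk_agree_lo i c hT rfl fun j hj => by simp [cmkGlue3, hj]

/-- Upper agreement of the glued configuration with the upper reference configuration. [folklore] -/
theorem cmk_conf_up (a θ b : SDE.KJ) :
    (∀ v : Site 2, i ≤ v 0 → v 0 ≤ i + 2 → c ≤ v 1 → (v ∈ (cmkConf i T c (a, θ, b)).1 ↔ v ∈ (cmkUconf i T c (θ, b)).1)) ∧
    (∀ f : Site 2, (f 0 = i ∨ f 0 = i + 1) → c + 1 ≤ f 1 → (f ∈ (cmkConf i T c (a, θ, b)).2 ↔ f ∈ (cmkUconf i T c (θ, b)).2)) :=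
  cmk_agree_up i c hT rfl (by omega) fun j hj => by
    rcases hj with hj | hj
    · by_cases hb : j ∈ cmkGb i (decide (i ∈ T)) c <;> simp [cmkGlue3, hj, hb]
    · simp [cmkGlue3, hj]

/-- (a) The middle row `0` and the middle rows `(c, 0)` of the glued configuration are the upper maps. [folklore] -/
theorem cmk_conf_Y_V (a θ b : SDE.KJ) :
    rowBool i (cmkConf i T c (a, θ, b)) = cmkY i T c (θ, b) ∧
      cmkTrunc c (pastMid i 0 (cmkConf i T c (a, θ, b))) = cmkV i T c (θ, b) := by
  obtain ⟨h1, h2⟩ := cmk_conf_up i c hT hc a θ b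
  refine ⟨?_, ?_⟩
  · simp only [cmkY, rowBool, h1 ![i + 1, 0] (by simp) (by simp) (by simp; omega),
      h2 ![i, 0] (Or.inl (by simp)) (by simp; omega), h2 ![i + 1, 0] (Or.inr (by simp)) (by simp; omega)]
  · refine Prod.ext (Set.ext fun v => ?_) (Set.ext fun f => ?_)
    · simp only [cmkV, cmkTrunc, pastMid, mem_setOf_eq]
      constructor
      · rintro ⟨⟨hv, h0, h0'⟩, hc'⟩; exact ⟨⟨(h1 v (by omega) (by omega) hc'.le).1 hv, h0, h0'⟩, hc'⟩
      · rintro ⟨⟨hv, h0, h0'⟩, hc'⟩; exact ⟨⟨(h1 v (by omega) (by omega) hc'.le).2 hv, h0, h0'⟩, hc'⟩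
    · simp only [cmkV, cmkTrunc, pastMid, mem_setOf_eq]
      constructor
      · rintro ⟨⟨hf, h0, h0'⟩, hc'⟩; exact ⟨⟨(h2 f h0 (by omega)).1 hf, h0, h0'⟩, hc'⟩
      · rintro ⟨⟨hf, h0, h0'⟩, hc'⟩; exact ⟨⟨(h2 f h0 (by omega)).2 hf, h0, h0'⟩, hc'⟩

omit hT hc in
/-- Upper half-strip reachability on `cmkFlat` reads only the upper strip. [folklore] -/
theorem cmk_UpR_flat_congr {x x' : Obs}
    (h1 : ∀ v : Site 2, i ≤ v 0 → v 0 ≤ i + 2 → c ≤ v 1 → (v ∈ x.1 ↔ v ∈ x'.1))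
    (h2 : ∀ f : Site 2, (f 0 = i ∨ f 0 = i + 1) → c + 1 ≤ f 1 → (f ∈ x.2 ↔ f ∈ x'.2)) :
    cmkUpR i c (cmkFlat i c x) = cmkUpR i c (cmkFlat i c x') := by
  have key : ∀ m : ℕ, cmkRW i c (c + m) (cmkFlat i c x) = cmkRW i c (c + m) (cmkFlat i c x') := by
    intro m
    have hf : ∀ {x x' : Obs}, (∀ f : Site 2, (f 0 = i ∨ f 0 = i + 1) → c + 1 ≤ f 1 → (f ∈ x.2 ↔ f ∈ x'.2)) →
        ∀ f : Site 2, (f 0 = i ∨ f 0 = i + 1) → c ≤ f 1 → f 1 < c + m → (f ∈ (cmkFlat i c x).2 ↔ f ∈ (cmkFlat i c x').2) := by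
      intro x x' h2 f hf0 hf1 _
      by_cases hfc : f 1 = c
      · have : f = ![i, c] ∨ f = ![i + 1, c] := by
          rcases hf0 with e | e
          · left; rw [← SDE.site2_eta f, e, hfc]
          · right; rw [← SDE.site2_eta f, e, hfc]
        simp only [cmkFlat, mem_setOf_eq]
        constructor <;> intro _ <;> exact Or.inr this
      · simp only [cmkFlat, mem_setOf_eq, h2 f hf0 (by omega)]
    exact Subset.antisymm (cmkRW_congr_obs i _ _ (fun v a b c' _ => h1 v a b c') (hf h2))
      (cmkRW_congr_obs i _ _ (fun v a b c' _ => (h1 v a b c').symm) (hf fun f a b => (h2 f a b).symm))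
  ext pq; simp only [cmkUpR, mem_setOf_eq, key]

omit hT hc in
/-- Lower half-strip reachability reads only the lower strip. [folklore] -/
theorem cmk_LoR_congr {x x' : Obs}
    (h1 : ∀ v : Site 2, i ≤ v 0 → v 0 ≤ i + 2 → v 1 ≤ c → (v ∈ x.1 ↔ v ∈ x'.1))
    (h2 : ∀ f : Site 2, (f 0 = i ∨ f 0 = i + 1) → f 1 < c → (f ∈ x.2 ↔ f ∈ x'.2)) :
    cmkLoR i c x = cmkLoR i c x' := by
  have key : ∀ m : ℕ, cmkRW i (c - m) c x = cmkRW i (c - m) c x' := fun m =>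
    Subset.antisymm (cmkRW_congr_obs i _ _ (fun v a b _ d => h1 v a b d) (fun f a _ b => h2 f a b))
      (cmkRW_congr_obs i _ _ (fun v a b _ d => (h1 v a b d).symm) (fun f a _ b => (h2 f a b).symm))
  ext pq; simp only [cmkLoR, mem_setOf_eq, key]

/-- The upper statistic of the glued configuration is the upper map. [folklore] -/
theorem cmk_conf_Ust (a θ b : SDE.KJ) : cmkUstat i c (cmkConf i T c (a, θ, b)) = cmkUst i T c (θ, b) := by
  obtain ⟨h1, h2⟩ := cmk_conf_up i c hT hc a θ b
  have e := cmk_UpR_flat_congr i c h1 h2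
  simp only [cmkUst, cmkUstat, cmkUpDp, e]

omit hc in
/-- The lower maps of the glued configuration are those of the lower reference configuration. [folklore] -/
theorem cmk_conf_lower (a θ b : SDE.KJ) :
    eraseMid i (cmkConf i T c (a, θ, b)) = eraseMid i (cmkLconf i T c (a, θ)) ∧
    pastMid i (c + 1) (cmkConf i T c (a, θ, b)) = pastMid i (c + 1) (cmkLconf i T c (a, θ)) ∧
    cmkLoR i c (cmkConf i T c (a, θ, b)) = cmkLoR i c (cmkLconf i T c (a, θ)) ∧
    (cmkPattern i c (cmkConf i T c (a, θ, b)) ↔ cmkPattern i c (cmkLconf i T c (a, θ))) := by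
  obtain ⟨hbd, hmid, hfc, hE⟩ := cmk_conf_lo i c hT a θ b
  refine ⟨hE, ?_, ?_, ?_⟩
  · refine Prod.ext (Set.ext fun w => ?_) (Set.ext fun f => ?_) <;> simp only [pastMid, mem_setOf_eq]
    · constructor
      · rintro ⟨hw, h0, h1⟩; exact ⟨(hmid w h0 (by omega)).1 hw, h0, h1⟩
      · rintro ⟨hw, h0, h1⟩; exact ⟨(hmid w h0 (by omega)).2 hw, h0, h1⟩
    · constructor
      · rintro ⟨hf, h0, h1⟩; exact ⟨(hfc f h0 (by omega)).1 hf, h0, h1⟩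
      · rintro ⟨hf, h0, h1⟩; exact ⟨(hfc f h0 (by omega)).2 hf, h0, h1⟩
  · exact cmk_LoR_congr i c (fun v hv hv' hv1 => by
      rcases (show v 0 = i ∨ v 0 = i + 1 ∨ v 0 = i + 2 by omega) with e | e | e
      · exact hbd v (Or.inl e)
      · exact hmid v e hv1
      · exact hbd v (Or.inr e)) (fun f hf hf1 => hfc f hf hf1.le)
  · have key : ∀ a' y : ℤ, (a' = i ∨ a' = i + 2) →
        ((![a', y] : Site 2) ∈ (cmkConf i T c (a, θ, b)).1 ↔ (![a', y] : Site 2) ∈ (cmkLconf i T c (a, θ)).1) :=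
      fun a' y h => hbd _ (by simpa using h)
    simp only [cmkPattern, key _ _ (Or.inl rfl), key _ _ (Or.inr rfl)]

/-- (b) THE CUT of the glued configuration, from the lower reference configuration and the upper statistic. [folklore] -/
theorem cmk_conf_isCut_iff (a θ b : SDE.KJ) :
    IsCut i c (pinnedStat i (cmkConf i T c (a, θ, b))) ↔ cmkC i c (cmkLconf i T c (a, θ)) (cmkUst i T c (θ, b)) := by
  obtain ⟨-, -, hL, hP⟩ := cmk_conf_lower i c hT a θ b
  rw [cmk_isCut_iff_cutLoc, ← cmk_conf_Ust i c hT hc a θ b, cmkCutLoc, cmkC, hP, hL]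
  simp only [cmkUstat]

omit hT in
/-- Rows `< 0` are the rows `≤ c` and the rows `(c, 0)`. [folklore] -/
theorem cmk_pastMid_split (x : Obs) : cmkUn (pastMid i (c + 1) x) (cmkTrunc c (pastMid i 0 x)) = pastMid i 0 x := by
  refine Prod.ext (Set.ext fun w => ?_) (Set.ext fun f => ?_) <;>
    simp only [cmkUn, cmkTrunc, pastMid, mem_union, mem_setOf_eq] <;> constructor
  · rintro (⟨h, h0, h1⟩ | ⟨⟨h, h0, h1⟩, -⟩) <;> exact ⟨h, h0, by omega⟩
  · rintro ⟨h, h0, h1⟩; by_cases hw : c < w 1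
    · exact Or.inr ⟨⟨h, h0, h1⟩, hw⟩
    · exact Or.inl ⟨h, h0, by omega⟩
  · rintro (⟨h, h0, h1⟩ | ⟨⟨h, h0, h1⟩, -⟩) <;> exact ⟨h, h0, by omega⟩
  · rintro ⟨h, h0, h1⟩; by_cases hw : c < f 1
    · exact Or.inr ⟨⟨h, h0, h1⟩, hw⟩
    · exact Or.inl ⟨h, h0, by omega⟩

/-- (c) AT A CUT ROW the row statistic is reassembled and the upper statistic is read off the strip diagram. [folklore] -/
theorem cmk_conf_cut (a θ b : SDE.KJ) (hcut : IsCut i c (pinnedStat i (cmkConf i T c (a, θ, b)))) :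
    cmkRS i c (cmkLconf i T c (a, θ)) (cmkUst i T c (θ, b)) (cmkV i T c (θ, b)) = rowStat i (cmkConf i T c (a, θ, b)) ∧
    cmkUst i T c (θ, b) = cmkPi2' i c (stripDiagram i (cmkConf i T c (a, θ, b))) := by
  obtain ⟨hE, hW, hL, -⟩ := cmk_conf_lower i c hT a θ b
  have hU := cmk_conf_Ust i c hT hc a θ b
  have hV := (cmk_conf_Y_V i c hT hc a θ b).2
  have hflat := cmk_isCut_UpR_flat hcut
  obtain ⟨-, -, -, hnU, hpU⟩ := cmk_isCut_imp_cutLoc hcut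
  have hUpDp : cmkUpDp i c (cmkFlat i c (cmkConf i T c (a, θ, b))) = cmkUpDp i c (cmkConf i T c (a, θ, b)) := by
    simp only [cmkUpDp, hflat]
  rw [← hU, ← hV]
  refine ⟨Prod.ext (Prod.ext ?_ ?_) ?_, Prod.ext ?_ (Prod.ext ?_ ?_)⟩
  · show eraseMid i (cmkLconf i T c (a, θ)) = eraseMid i (cmkConf i T c (a, θ, b)); rw [hE]
  · show cmkComb i c (cmkLoR i c (cmkLconf i T c (a, θ))) (cmkUpDp i c (cmkFlat i c (cmkConf i T c (a, θ, b)))) =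
      stripDiagram i (cmkConf i T c (a, θ, b))
    rw [← hL, hUpDp, ← cmk_stripDiagram_eq_comb i c _ hcut]
  · show cmkUn (pastMid i (c + 1) (cmkLconf i T c (a, θ))) (cmkTrunc c (pastMid i 0 (cmkConf i T c (a, θ, b)))) =
      pastMid i 0 (cmkConf i T c (a, θ, b))
    rw [← hW, cmk_pastMid_split i c hc]
  · show cmkUpDp i c (cmkFlat i c (cmkConf i T c (a, θ, b))) = cmkPi2 i c (stripDiagram i (cmkConf i T c (a, θ, b)))
    rw [hUpDp, cmk_pi2_stripDiagram hcut]
  · exact propext (iff_true_intro hpU)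
  · exact propext (iff_true_intro hnU)

end Key

/-! ## The shared coordinates read off the environment -/

section Gamma

variable (i : ℤ) {T : Set ℤ} (c : ℤ) (hT : i ∈ T ↔ i + 1 ∉ T) {τ : Bool} (hτ : decide (i ∈ T) = τ)
include hT hτ

omit hT hτ in
/-- `bp f u u = false`. [folklore] -/
theorem cmk_bp_self (f : ℤ → Bool) (u : ℤ) : SDE.bp f u u = false := by unfold SDE.bp; simp

/-- The boundary data read on the environment of a cut-adapted configuration. [folklore] -/
theorem cmk_env_reads (g : SDE.KJ) (y : ℤ) :
    cmkξE i (eraseMid i (cmkΞ i T c g)) y = cmkXi g y ∧ cmkζE i (eraseMid i (cmkΞ i T c g)) y = cmkZe i τ g y ∧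
      cmkFE i (eraseMid i (cmkΞ i T c g)) y = cmkF i τ g y := by
  have hi : (i : ℤ) ≠ i + 1 := by omega
  have hi2 : (i + 2 : ℤ) ≠ i + 1 := by omega
  have hξ : ∀ y, cmkξE i (eraseMid i (cmkΞ i T c g)) y = cmkXi g y := fun y => by
    rw [cmkξE, crk_mem_eraseMid_fst i _ _ _ hi, cmk_mem_Xi_col0 i c hτ g _ (by simp)]; simp
  have hζ : ∀ y, cmkζE i (eraseMid i (cmkΞ i T c g)) y = cmkZe i τ g y := fun y => by
    rw [cmkζE, crk_mem_eraseMid_fst i _ _ _ hi2, cmk_mem_Xi_col2 i c hT hτ g _ (by simp)]; simp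
  refine ⟨hξ y, hζ y, ?_⟩
  rw [cmkFE, hξ, hξ, hζ, hζ]
  simp only [cmkXi, cmkZe, SDE.bp_succ]
  cases g (jCB (i + 2)) <;> cases g (jRB (y + 1)) <;> cases g (jRB y) <;> cases SDE.bp (cmkF i τ g) 0 y <;> cases cmkF i τ g y <;> rfl

/-- THE SHARED COORDINATES ARE READ OFF THE ENVIRONMENT at a cut row: for a shared sample `θ` supported on the shared
coordinates, `θ = cmkΓ (eraseMid x)`. [folklore] -/
theorem cmk_conf_gamma (a θ b : SDE.KJ) (hθ : cmkPr i τ c θ = θ)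
    (hcut : IsCut i c (pinnedStat i (cmkConf i T c (a, θ, b)))) : θ = cmkΓ i τ c (eraseMid i (cmkConf i T c (a, θ, b))) := by
  subst hτ
  set g := cmkGlue3 i (decide (i ∈ T)) c (a, θ, b) with hg
  have hx : cmkConf i T c (a, θ, b) = cmkΞ i T c g := rfl
  obtain ⟨hGx, hGr, hGF, -, -, -⟩ := cmk_mem_Gb i (decide (i ∈ T)) c
  obtain ⟨hE1, hE2, hEr, hEF, hEFg⟩ := cmk_mem_Ge i (decide (i ∈ T)) c
  have hθg : ∀ j, j ∈ cmkGe i (decide (i ∈ T)) c → j ∉ cmkGb i (decide (i ∈ T)) c → θ j = g j := fun j h1 h2 => by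
    simp [hg, cmkGlue3, h1, h2]
  have hθ0 : ∀ j, j ∉ cmkGe i (decide (i ∈ T)) c → θ j = false := fun j hj => by
    rw [← hθ]; simp [cmkPr, hj]
  -- the forced middle colour at the cut gives the column bit of column `i+1`
  have hmid : g (jCB (i + 1)) = !(!decide (i ∈ T) && SDE.bp (cmkF i (decide (i ∈ T)) g) 0 c) := by
    have h1 := isCut_forces_mid i c _ hcut c (by omega) (by omega)
    rw [hx, cmk_mem_Xi_col1 i c rfl g _ (by simp), cmk_mem_Xi_col0 i c rfl g _ (by simp)] at h1
    have e1 : (![i + 1, c] : Site 2) 1 = c := by simp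
    have e0 : (![i, c] : Site 2) 1 = c := by simp
    rw [e1, e0] at h1
    unfold cmkMi cmkXi at h1
    rw [cmk_bp_self, Bool.xor_false] at h1
    revert h1
    cases g (jCB (i + 1)) <;> cases g (jRB c) <;> cases (!decide (i ∈ T) && SDE.bp (cmkF i (decide (i ∈ T)) g) 0 c) <;> decide
  have hF : cmkFE i (eraseMid i (cmkΞ i T c g)) = cmkF i (decide (i ∈ T)) g := funext fun y => (cmk_env_reads i c hT rfl g y).2.2
  have d12 : decide (i + 1 = i + 2) = false := decide_eq_false (by omega)
  have d21 : decide (i + 2 = i + 1) = false := decide_eq_false (by omega)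
  funext j
  rw [hx]
  rcases j with x | y | f | f | f
  · by_cases h2 : x = i + 2
    · subst h2
      change θ (jCB (i + 2)) = _
      rw [hθg _ hE2 (hGx _)]
      obtain ⟨hξ, hζ, -⟩ := cmk_env_reads i c hT rfl g 0
      simp only [cmkΓ, hξ, hζ, cmkXi, cmkZe, SDE.bp_zero, Bool.xor_false, decide_true, Bool.true_and, d21,
        Bool.false_and, Bool.or_false]
      show g (jCB (i + 2)) = _
      cases g (jCB (i + 2)) <;> cases g (jRB 0) <;> rfl
    · by_cases h1 : x = i + 1
      · subst h1
        change θ (jCB (i + 1)) = _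
        rw [hθg _ hE1 (hGx _)]
        simp only [cmkΓ, hF, decide_true, Bool.true_and, d12, Bool.false_and, Bool.false_or]
        exact hmid
      · have hnot : Sum.inl x ∉ cmkGe i (decide (i ∈ T)) c := by
          simp only [cmkGe, mem_setOf_eq, jCB, jRB, jFP, Sum.inl.injEq, reduceCtorEq, and_false, exists_false, or_false]
          omega
        have dx2 : decide (x = i + 2) = false := decide_eq_false h2
        have dx1 : decide (x = i + 1) = false := decide_eq_false h1
        rw [hθ0 _ hnot]
        simp only [cmkΓ, dx2, dx1, Bool.false_and, Bool.false_or]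
  · change θ (jRB y) = _
    by_cases hy : c ≤ y
    · rw [hθg _ ((hEr y).2 hy) (hGr _)]
      obtain ⟨hξ, -, -⟩ := cmk_env_reads i c hT rfl g y
      have dy : decide (c ≤ y) = true := decide_eq_true hy
      simp only [cmkΓ, jRB, hξ, cmkXi, dy, Bool.true_and]
    · rw [hθ0 _ (fun h => hy ((hEr y).1 h))]
      have dy : decide (c ≤ y) = false := decide_eq_false hy
      show false = (decide (c ≤ y) && _)
      rw [dy, Bool.false_and]
  · rw [hθ0 _ (by simp [cmkGe, jCB, jRB, jFP])]; rfl
  · by_cases hf : f 0 = SDE.hcC i (decide (i ∈ T)) ∧ c ≤ f 1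
    · have hfe : f = ![SDE.hcC i (decide (i ∈ T)), f 1] := by rw [SDE.site2_eq_iff]; simp [hf.1]
      change θ (jFP f) = _
      rw [hfe, hθg _ ((hEF (f 1)).2 hf.2) (hGF _)]
      obtain ⟨-, -, hF1⟩ := cmk_env_reads i c hT rfl g (f 1)
      have e0 : (![SDE.hcC i (decide (i ∈ T)), f 1] : Site 2) 0 = SDE.hcC i (decide (i ∈ T)) := by simp
      have e1 : (![SDE.hcC i (decide (i ∈ T)), f 1] : Site 2) 1 = f 1 := by simp
      have d : decide ((![SDE.hcC i (decide (i ∈ T)), f 1] : Site 2) 0 = SDE.hcC i (decide (i ∈ T)) ∧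
          c ≤ (![SDE.hcC i (decide (i ∈ T)), f 1] : Site 2) 1) = true := decide_eq_true (by rw [e0, e1]; exact ⟨rfl, hf.2⟩)
      show g (jFP ![SDE.hcC i (decide (i ∈ T)), f 1]) = (decide ((![SDE.hcC i (decide (i ∈ T)), f 1] : Site 2) 0 =
        SDE.hcC i (decide (i ∈ T)) ∧ c ≤ (![SDE.hcC i (decide (i ∈ T)), f 1] : Site 2) 1) &&
          cmkFE i (eraseMid i (cmkΞ i T c g)) ((![SDE.hcC i (decide (i ∈ T)), f 1] : Site 2) 1))
      rw [d, e1, hF1, Bool.true_and]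
      rfl
    · change θ (jFP f) = _
      rw [hθ0 _ (fun h => hf (hEFg f h))]
      have df : decide (f 0 = SDE.hcC i (decide (i ∈ T)) ∧ c ≤ f 1) = false := decide_eq_false hf
      show false = (decide (f 0 = SDE.hcC i (decide (i ∈ T)) ∧ c ≤ f 1) && cmkFE i (eraseMid i (cmkΞ i T c g)) (f 1))
      rw [df, Bool.false_and]
  · rw [hθ0 _ (by simp [cmkGe, jCB, jRB, jFP])]; rfl

end Gamma

/-- THE CUT OF THE GLUED CONFIGURATION from the lower reference configuration and the upper statistic (registered
sub-goal `cmk_key`, the form consumed by the abstract sufficiency lemma). [folklore] -/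
theorem cmk_key : ∀ (i : ℤ) (T : Set ℤ) (c : ℤ), (i ∈ T ↔ i + 1 ∉ T) → c ≤ -1 → ∀ (a θ b : SDE.KJ), (IsCut i c (pinnedStat i (cmkConf i T c (a, θ, b))) ↔ cmkC i c (cmkLconf i T c (a, θ)) (cmkUst i T c (θ, b))) :=
  fun i _ c hT hc a θ b => cmk_conf_isCut_iff i c hT hc a θ b

end Summit.CriticalPhenomena.CardyFormulaZ2.Theorems.IKLinearTransport.PinnedDiagramExchange
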